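import Summits.Langlands.Langlands.Theses.SkinnerWilesDefectOne

/-!
# `ProModularOrdinaryClassical` (stmt-Langlands-12921) — Negative knowledge I: hypothesis hygiene

From the standing disprover's `Cruxes/ProModularOrdinaryClassical/Disproof.lean` (cdisprove
cycle 1, 2026-08-16). The crux (route SkinnerWilesDefectOne, THE EXIT: pro-modular + ordinary of
one parallel weight `k ≥ 2` ⇒ classical, `GL₂` over an imaginary quadratic field) is NOT refuted —
it is implied by Fontaine–Mazur–Langlands (B) restricted to its sector (see `Disproof.lean`,
`crux_of_ordinaryFontaineMazur`). This file lands the hypothesis-hygiene lemmas provers can cite: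

* `eventually_isUnramifiedAt_of_isPadicallyAutomorphic` — pro-modularity of tame level `𝒰`
  already gives `∀ᶠ v in cofinite, ρ.IsUnramifiedAt v` (unramified off the finite `𝒰.bad`): the
  crux's a.e.-unramified hypothesis is decoration.
* `exists_uniform_exponent` — "some inertial exponent `m_v > 0` at each `v ∣ p`" ⇔ "one `m > 0`
  for all `v ∣ p`" (finitely many places above `p`; `IsOrdinaryOfWeightAt.of_dvd`).
* `isOrdinaryOfWeight_exponent_zero_iff`, `isOrdinaryOfWeight_exponent_zero_weight_irrel` — with
  exponent `m = 0` both inertial clauses are `x ^ 0 = y ^ 0`: "ordinary of weight `k`" collapses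
  to "upper-triangularisable on `Γ_L`" and the weight disappears (so the crux's `0 < m` is
  load-bearing: without it the statement would claim classicality of every locally reducible
  pro-modular `ρ`).
* `isOrdinaryOfWeight_weight_zero_iff_one` — `k = 0` is ℕ-subtraction junk for `k = 1`.
* `satakeConclusion_of_galoisToAutomorphic` — one instance of the crux's conclusion from the
  summit's conjunct (B) for `n = 2` and an `𝓡`-geometric `ρ` (the Satake clause is the first
  conjunct of `Corresponds`).

Mathlib + the route file only. [folklore]
-/

set_option linter.dupNamespace false

namespace Summit.Langlands.Langlands.Theorems.ProModularOrdinaryClassical.Negative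

open Literature.NumberTheory.Automorphic Literature.NumberTheory.GaloisRepresentations
open Literature.NumberTheory.Automorphic.BigHeckeGLn
open NumberField IsDedekindDomain Filter

/-- **Pro-modular ⇒ unramified almost everywhere.** `𝒰.IsPadicallyAutomorphic ρ` contains, through
`IsAssociated`/`IsAssociatedFamily`, `ρ.IsUnramifiedAt v` for every `v ∉ 𝒰.bad`, and `𝒰.bad` is
finite. So the hypothesis `∀ᶠ v in cofinite, ρ.IsUnramifiedAt v` of `ProModularOrdinaryClassical`
is implied by its pro-modularity hypothesis. Any rank `n`, any coefficients. [folklore] -/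
theorem eventually_isUnramifiedAt_of_isPadicallyAutomorphic {n : ℕ} {F : Type} [Field F]
    [NumberField F] {p : ℕ} [Fact p.Prime] (𝒰 : TameLevel n F p) {A : Type*} [CommRing A]
    [TopologicalSpace A] {ρ : FramedGaloisRep F A n} (h : 𝒰.IsPadicallyAutomorphic ρ) :
    ∀ᶠ v in cofinite, ρ.IsUnramifiedAt v := by
  obtain ⟨x, -, hx⟩ := h
  refine Filter.eventually_cofinite.2 (𝒰.bad_finite.subset fun v hv => ?_)
  by_contra hvb
  exact hv (hx v hvb).1

/-- **Per-place exponents ⇔ one exponent.** Since only finitely many places divide `p`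
(`finite_setOf_natCast_mem_asIdeal`) and `IsOrdinaryOfWeightAt` is monotone along divisibility
of the exponent (`IsOrdinaryOfWeightAt.of_dvd`), "some `m_v > 0` at each `v ∣ p`" is equivalent
to "one `m > 0` for all `v ∣ p`" (take the product of the `m_v`). So the uniform exponent in
`ProModularOrdinaryClassical` (and in the route's target / engine) is not a restriction.
[folklore] -/
theorem exists_uniform_exponent {F : Type} [Field F] [NumberField F] {p : ℕ} [Fact p.Prime]
    {A : Type*} [CommRing A] [TopologicalSpace A] [Algebra ℤ_[p] A]
    (ρ : FramedGaloisRep F A 2) (k : ℕ) :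
    (∀ v : HeightOneSpectrum (𝓞 F), (p : 𝓞 F) ∈ v.asIdeal →
        ∃ m, 0 < m ∧ ρ.IsOrdinaryOfWeightAt p v k m) ↔
      ∃ m, 0 < m ∧ ∀ v : HeightOneSpectrum (𝓞 F), (p : 𝓞 F) ∈ v.asIdeal →
        ρ.IsOrdinaryOfWeightAt p v k m := by
  constructor
  · intro h
    have hfin := BigHeckeGLn.finite_setOf_natCast_mem_asIdeal F p
    choose! m hm using h
    refine ⟨∏ v ∈ hfin.toFinset, m v, Finset.prod_pos fun v hv => (hm v (hfin.mem_toFinset.1 hv)).1,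
      fun v hv => ?_⟩
    exact (hm v hv).2.of_dvd (Finset.dvd_prod_of_mem m (hfin.mem_toFinset.2 hv))
  · rintro ⟨m, hm, h⟩ v hv
    exact ⟨m, hm, h v hv⟩

/-- **Exponent zero kills the weight.** With `m = 0` both inertial clauses of
`IsOrdinaryOfWeight` read `x ^ 0 = y ^ 0`, so "ordinary of weight `k` with exponent `0`" is just
"upper-triangularisable on `Γ_L`", for EVERY `k`. Hence `ProModularOrdinaryClassical` without its
side condition `0 < m` would assert the classicality of every irreducible pro-modular `ρ` whose
restrictions to `Γ_{F_v}`, `v ∣ p`, are reducible (e.g. every non-classical member of a nearly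
ordinary family): `0 < m` is load-bearing. [folklore] -/
theorem isOrdinaryOfWeight_exponent_zero_iff {L : Type*} [Field L] [ValuativeRel L]
    [TopologicalSpace L] [IsNonarchimedeanLocalField L] {A : Type*} [CommRing A]
    [TopologicalSpace A] (p : ℕ) [Fact p.Prime] [Algebra ℤ_[p] A] (ρ : FramedGaloisRep L A 2)
    (k : ℕ) :
    ρ.IsOrdinaryOfWeight p k 0 ↔
      ∃ Q : GL (Fin 2) A, ∀ σ : Field.absoluteGaloisGroup L, (Q⁻¹ * ρ σ * Q).val 1 0 = 0 := by
  simp [FramedGaloisRep.IsOrdinaryOfWeight]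

/-- With exponent `0` the weight is irrelevant: weight `k` and weight `k'` coincide. [folklore] -/
theorem isOrdinaryOfWeight_exponent_zero_weight_irrel {L : Type*} [Field L] [ValuativeRel L]
    [TopologicalSpace L] [IsNonarchimedeanLocalField L] {A : Type*} [CommRing A]
    [TopologicalSpace A] (p : ℕ) [Fact p.Prime] [Algebra ℤ_[p] A] (ρ : FramedGaloisRep L A 2)
    (k k' : ℕ) : ρ.IsOrdinaryOfWeight p k 0 ↔ ρ.IsOrdinaryOfWeight p k' 0 := by
  rw [isOrdinaryOfWeight_exponent_zero_iff, isOrdinaryOfWeight_exponent_zero_iff]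

/-- **Weight "0" is weight 1**: the exponent `(k - 1) * m` uses ℕ-subtraction, so `k = 0` and
`k = 1` give the same predicate (finite order on inertia for both diagonal characters: the
potentially-unramified-at-`p`, Artin-type slice). `ProModularOrdinaryClassical` excludes both by
`2 ≤ k`. [folklore] -/
theorem isOrdinaryOfWeight_weight_zero_iff_one {L : Type*} [Field L] [ValuativeRel L]
    [TopologicalSpace L] [IsNonarchimedeanLocalField L] {A : Type*} [CommRing A]
    [TopologicalSpace A] (p : ℕ) [Fact p.Prime] [Algebra ℤ_[p] A] (ρ : FramedGaloisRep L A 2)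
    (m : ℕ) : ρ.IsOrdinaryOfWeight p 0 m ↔ ρ.IsOrdinaryOfWeight p 1 m :=
  Iff.rfl

/-- **The crux's conclusion from the summit's (B), one `ρ` at a time**: if `𝓡` are reciprocity
data for `F` with `GaloisToAutomorphic n 𝓡 hcpt` and `ρ` is irreducible and `𝓡`-geometric, then
there is an L-algebraic cuspidal `π` with Satake–Frobenius matching at almost all `v` (the first
conjunct of `Corresponds`). With the bridge "ordinary of weight `k ≥ 2` ⇒ `IsGeometricFramed 𝓡`"
this places `ProModularOrdinaryClassical` inside the summit: no refutation of the crux avoids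
refuting `Langlands`. [folklore] -/
theorem satakeConclusion_of_galoisToAutomorphic {n : ℕ} {F : Type} [Field F] [NumberField F]
    {p : ℕ} [Fact p.Prime] (hcpt : isCompact_glFiniteIntegralLevel n F)
    (𝓡 : Summit.Langlands.ReciprocityData F) (hB : Summit.Langlands.GaloisToAutomorphic n 𝓡 hcpt)
    (ι : PadicAlgCl p ≃+* ℂ) (ρ : FramedGaloisRep F (PadicAlgCl p) n)
    (hirr : ρ.toGaloisRep.IsIrreducible) (hgeom : Summit.Langlands.IsGeometricFramed 𝓡 ρ) :
    ∃ π : CuspidalAutomorphicRepData n F hcpt, π.1.IsLAlgebraic ∧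
      ∀ᶠ v in cofinite, Summit.Langlands.SatakeFrobCompatibleAt ι π.1 ρ v := by
  obtain ⟨π, hL, hcorr⟩ := hB p ι ρ hirr hgeom
  exact ⟨π, hL, hcorr.1⟩

end Summit.Langlands.Langlands.Theorems.ProModularOrdinaryClassical.Negative
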